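import Mathlib.Analysis.InnerProductSpace.PiL2
import Mathlib.Data.Fin.Tuple.Basic
import Mathlib.Data.Fin.Embedding
import Literature.Geometry.DiscreteGeometry.BondGraph
import Literature.MathematicalPhysics.StatisticalMechanics.LennardJonesClusters
import HarnessLib

/-!
# `ChargedEnergyGap` (stmt-AtomisticToContinuum-14231), line `barlow-relative-pricing`:
# the charge recount under deletion of one particle

The COUNTING step of the line (stub `stub_chargeRecount`, feeding the closest-pair deletion
induction `stub_regularise`).  For an injective configuration `x : Fin (N + 1) → ℝ³` and a site
`i₀`, write `x' = x ∘ i₀.succAbove` for the configuration with the particle `x i₀` deleted, and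
call a site CHARGED when it is not charge-free at tolerance `η = 1/100`
(`Literature.Geometry.DiscreteGeometry.IsChargeFree`: twelve bonds in the scale-free bond graph
`bondGraph η`, ring number `4` across each).  Then
`#charged(x) ≤ #charged(x') + 812` (`stub_chargeRecount`, with `F = 812`).

Proof.  If `N ≤ 1` the left side is `≤ N + 1 ≤ 2`.  Otherwise every site of `x'` has another
site, and the own scale of a surviving site can only grow under deletion
(`nearestDist_succAbove_le`, `nearestDist_succAbove_eq`).  A charged site of `x` is `i₀`, or
`i₀.succAbove i'` with `i'` charged in `x'`, or `i₀.succAbove i'` with `i'` charge-free in `x'`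
but not in `x` (a FLIPPED site).  STRUCTURE LEMMA (`isChargeFree_succAbove`): a flipped site
`i'` is either (a) bonded to `i₀` in `x`, or (b) some `k' ∈ {i'} ∪ N'(i')` has `x i₀` as its
new STRICT nearest neighbour, `dist (x' k') (x i₀) < nn_{x'}(k')` — for otherwise the scales on
`{i'} ∪ N'(i')` are unchanged, so are the bonds among these sites (`adj_succAbove_iff`), the
neighbour set of `i₀.succAbove i'` in `x` is the image of `N'(i')` (`i₀` itself is excluded by
`¬ (a)`, and a bond of `x` between surviving sites is a bond of `x'`,
`adj_comp_of_adj_succAbove`), and so are the common-neighbour sets across its bonds; hence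
`i₀.succAbove i'` would be charge-free in `x`.  COUNTS, by the packing bound
`card_le_of_separated_of_dist_le` in `ℝ³`: (a) the sites bonded to `i₀` lie within `1.01 ρ` of
`x i₀`, `ρ = nn_x(i₀) > 0`, and are pairwise `≥ ρ/1.01` apart, so there are at most
`⌊(2·1.01² + 1)³⌋ = 28` of them (`card_le_of_adj_deleted`); (b) the sites `k'` with
`dist (x' k') (x i₀) < nn_{x'}(k')` number at most `27`: the unit vectors of `x' k' − x i₀` are
pairwise `> 1` apart (`one_lt_norm_sub_normalize`: `|u − v| > |u|, |v|` forces
`2⟪u, v⟫ < |u| |v|`), packing in the unit ball (`card_le_of_strict`); and each of them accounts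
for itself and its `≤ 28` neighbours (`card_le_of_adj`, same packing as (a)).
Total `1 + 28 + 27 · 29 = 812`.  All `[folklore]`.
-/

noncomputable section

open scoped Classical
open Literature.MathematicalPhysics.StatisticalMechanics Literature.Geometry.DiscreteGeometry

namespace Summit.AtomisticToContinuum.Crystallization.Theorems.BarlowRelativePricingRecount

/-! ### Two packing counts in `ℝ³` -/

/-- At most `28` points pairwise `≥ s/1.01` apart in a closed ball of radius `1.01 s` (`s > 0`):
`(2 · 1.01² + 1)³ < 29`. [folklore] -/
theorem card_le_28 (S : Finset (EuclideanSpace ℝ (Fin 3))) (p : EuclideanSpace ℝ (Fin 3)) {s : ℝ}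
    (hs : 0 < s) (hball : ∀ c ∈ S, dist c p ≤ (1 + 1 / 100) * s)
    (hsep : ∀ c ∈ S, ∀ d ∈ S, c ≠ d → s / (1 + 1 / 100) ≤ dist c d) : S.card ≤ 28 := by
  have h := card_le_of_separated_of_dist_le S p (by positivity : (0 : ℝ) < s / (1 + 1 / 100))
    (by positivity : (0 : ℝ) ≤ (1 + 1 / 100) * s) hball hsep
  rw [finrank_euclideanSpace, Fintype.card_fin] at h
  have hq : (2 * ((1 + 1 / 100) * s) / (s / (1 + 1 / 100)) + 1 : ℝ) =
      2 * (1 + 1 / 100) ^ 2 + 1 := by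
    field_simp
  rw [hq] at h
  exact Nat.lt_succ_iff.1 (by exact_mod_cast (lt_of_le_of_lt h (by norm_num) : (S.card : ℝ) < 29))

/-- At most `27` points pairwise `≥ 1` apart in the closed unit ball: `(2 + 1)³ = 27`. [folklore] -/
theorem card_le_27 (S : Finset (EuclideanSpace ℝ (Fin 3))) (hball : ∀ c ∈ S, dist c 0 ≤ 1)
    (hsep : ∀ c ∈ S, ∀ d ∈ S, c ≠ d → (1 : ℝ) ≤ dist c d) : S.card ≤ 27 := by
  have h := card_le_of_separated_of_dist_le S 0 one_pos zero_le_one hball hsep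
  rw [finrank_euclideanSpace, Fintype.card_fin] at h
  exact_mod_cast (h.trans (by norm_num) : (S.card : ℝ) ≤ 27)

/-- **Common strict nearest neighbour ⇒ angular separation.**  If `|u − v|` exceeds both `|u|`
and `|v|` (`u, v ≠ 0`), then the unit vectors of `u` and `v` are more than `1` apart:
`2⟪u, v⟫ < min (|u|², |v|²) ≤ |u| |v|`, so `‖û − v̂‖² = 2 − 2⟪û, v̂⟫ > 1`. [folklore] -/
theorem one_lt_norm_sub_normalize {V : Type*} [NormedAddCommGroup V] [InnerProductSpace ℝ V]
    {u v : V} (hu : u ≠ 0) (hv : v ≠ 0) (huv : ‖u‖ < ‖u - v‖) (hvu : ‖v‖ < ‖u - v‖) :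
    1 < ‖(‖u‖⁻¹ : ℝ) • u - (‖v‖⁻¹ : ℝ) • v‖ := by
  have hu0 : 0 < ‖u‖ := norm_pos_iff.2 hu
  have hv0 : 0 < ‖v‖ := norm_pos_iff.2 hv
  have h1 : ‖u‖ ^ 2 < ‖u - v‖ ^ 2 := by gcongr
  have h2 : ‖v‖ ^ 2 < ‖u - v‖ ^ 2 := by gcongr
  rw [norm_sub_sq_real] at h1 h2
  have key : 2 * inner ℝ u v < ‖u‖ * ‖v‖ := by
    rcases le_total ‖u‖ ‖v‖ with hle | hle
    · nlinarith [mul_le_mul_of_nonneg_left hle hu0.le]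
    · nlinarith [mul_le_mul_of_nonneg_right hle hv0.le]
  have hn : ‖(‖u‖⁻¹ : ℝ) • u - (‖v‖⁻¹ : ℝ) • v‖ ^ 2 = 2 - 2 * inner ℝ u v / (‖u‖ * ‖v‖) := by
    rw [norm_sub_sq_real, norm_smul, norm_smul, real_inner_smul_left, real_inner_smul_right,
      norm_inv, norm_inv, norm_norm, norm_norm, inv_mul_cancel₀ hu0.ne', inv_mul_cancel₀ hv0.ne']
    field_simp
    ring
  have hlt : (1 : ℝ) ^ 2 < ‖(‖u‖⁻¹ : ℝ) • u - (‖v‖⁻¹ : ℝ) • v‖ ^ 2 := by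
    have : 2 * inner ℝ u v / (‖u‖ * ‖v‖) < 1 := by
      rw [div_lt_iff₀ (mul_pos hu0 hv0)]; linarith
    rw [hn, one_pow]; linarith
  exact (pow_lt_pow_iff_left₀ zero_le_one (norm_nonneg _) two_ne_zero).1 hlt

/-! ### Sites, scales and bonds of a finite configuration -/

variable {n N : ℕ}

/-- With `2 ≤ n` every index of `Fin n` has another one. [folklore] -/
theorem exists_ne_fin (hn : 2 ≤ n) (j : Fin n) : ∃ k : Fin n, k ≠ j := by
  haveI : Nontrivial (Fin n) := Fin.nontrivial_iff_two_le.2 hn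
  exact exists_ne j

/-- The own scale of an injective configuration with at least two sites is positive. [folklore] -/
theorem nearestDist_pos (hn : 2 ≤ n) {y : Fin n → EuclideanSpace ℝ (Fin 3)}
    (hy : Function.Injective y) (k : Fin n) : 0 < nearestDist y k := by
  obtain ⟨j, hj, hjd⟩ := exists_nearestDist_eq_dist y (j := k) (exists_ne_fin hn k)
  rw [hjd]
  exact dist_pos.2 fun e => hj (hy e).symm

/-- **Degree bound.**  A site `k` of an injective configuration has at most `28` bonds: its
neighbours lie within `1.01 · nn_k` of it and are pairwise `≥ nn_k / 1.01` apart. [folklore] -/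
theorem card_le_of_adj (hn : 2 ≤ n) {y : Fin n → EuclideanSpace ℝ (Fin 3)}
    (hy : Function.Injective y) (k : Fin n) {S : Finset (Fin n)}
    (hS : ∀ j ∈ S, (bondGraph (1 / 100 : ℝ) y).Adj k j) : S.card ≤ 28 := by
  have hspos : 0 < nearestDist y k := nearestDist_pos hn hy k
  rw [← Finset.card_image_of_injective S hy]
  refine card_le_28 _ (y k) hspos ?_ ?_
  · intro c hc
    obtain ⟨j, hj, rfl⟩ := Finset.mem_image.1 hc
    rw [dist_comm]
    exact dist_le_of_adj (by norm_num) (hS j hj)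
  · intro c hc d hd hcd
    obtain ⟨j, hj, rfl⟩ := Finset.mem_image.1 hc
    obtain ⟨l, hl, rfl⟩ := Finset.mem_image.1 hd
    have hjl : l ≠ j := fun e => hcd (by rw [e])
    have h1 : nearestDist y k ≤ (1 + 1 / 100) * nearestDist y j :=
      nearestDist_le_mul_of_adj (by norm_num) (hS j hj)
    have h2 : nearestDist y j ≤ dist (y j) (y l) := nearestDist_le_dist y hjl
    rw [div_le_iff₀ (by norm_num : (0 : ℝ) < 1 + 1 / 100)]
    linarith

/-! ### Scales and bonds under deletion of the particle `x i₀` -/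

section Deletion

variable (x : Fin (N + 1) → EuclideanSpace ℝ (Fin 3)) (i₀ : Fin (N + 1))

/-- Deleting a particle can only raise the own scale of a surviving site (`N ≥ 2`). [folklore] -/
theorem nearestDist_succAbove_le (hN : 2 ≤ N) (i' : Fin N) :
    nearestDist x (i₀.succAbove i') ≤ nearestDist (x ∘ i₀.succAbove) i' :=
  le_nearestDist (exists_ne_fin hN i') fun _ hk' =>
    nearestDist_le_dist x fun h => hk' (Fin.succAbove_right_injective h)

/-- If the deleted particle is no closer to `x' i'` than the other survivors, the own scale of
`i'` is unchanged. [folklore] -/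
theorem nearestDist_succAbove_eq (hN : 2 ≤ N) {i' : Fin N}
    (h : nearestDist (x ∘ i₀.succAbove) i' ≤ dist (x (i₀.succAbove i')) (x i₀)) :
    nearestDist x (i₀.succAbove i') = nearestDist (x ∘ i₀.succAbove) i' := by
  refine le_antisymm (nearestDist_succAbove_le x i₀ hN i') ?_
  refine le_nearestDist ⟨i₀, Fin.ne_succAbove i₀ i'⟩ fun k hk => ?_
  rcases Fin.eq_self_or_eq_succAbove i₀ k with rfl | ⟨k', rfl⟩
  · exact h
  · exact nearestDist_le_dist (x ∘ i₀.succAbove) fun e => hk (by rw [e])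

/-- Bonds between surviving sites whose scales are unchanged are the same in `x` and `x'`.
[folklore] -/
theorem adj_succAbove_iff {η : ℝ} {j' k' : Fin N}
    (hj : nearestDist x (i₀.succAbove j') = nearestDist (x ∘ i₀.succAbove) j')
    (hk : nearestDist x (i₀.succAbove k') = nearestDist (x ∘ i₀.succAbove) k') :
    (bondGraph η x).Adj (i₀.succAbove j') (i₀.succAbove k') ↔
      (bondGraph η (x ∘ i₀.succAbove)).Adj j' k' := by
  simp only [bondGraph_adj, hj, hk, ne_eq, Fin.succAbove_right_inj, Function.comp_apply]

/-- A bond of `x` between surviving sites is a bond of `x'` (`η ≥ −1`, `N ≥ 2`). [folklore] -/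
theorem adj_comp_of_adj_succAbove {η : ℝ} (hη : 0 ≤ 1 + η) (hN : 2 ≤ N) {i' j' : Fin N}
    (h : (bondGraph η x).Adj (i₀.succAbove i') (i₀.succAbove j')) :
    (bondGraph η (x ∘ i₀.succAbove)).Adj i' j' := by
  obtain ⟨hne, hle⟩ := bondGraph_adj.1 h
  refine bondGraph_adj.2 ⟨fun e => hne (by rw [e]), hle.trans ?_⟩
  exact mul_le_mul_of_nonneg_left (min_le_min (nearestDist_succAbove_le x i₀ hN i')
    (nearestDist_succAbove_le x i₀ hN j')) hη

/-- **Structure lemma.**  A site `i'` charge-free in `x'`, not bonded to `i₀` in `x`, and such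
that the deleted particle is the strict nearest neighbour of no site of `{i'} ∪ N'(i')`, is
charge-free in `x`: its neighbour set and the rings across its bonds are the `i₀.succAbove`-images
of those in `x'`. [folklore] -/
theorem isChargeFree_succAbove {η : ℝ} (hη : 0 ≤ 1 + η) (hN : 2 ≤ N) {i' : Fin N}
    (hcf : IsChargeFree η (x ∘ i₀.succAbove) i')
    (ha : ¬ (bondGraph η x).Adj (i₀.succAbove i') i₀)
    (hb : ∀ k', (k' = i' ∨ (bondGraph η (x ∘ i₀.succAbove)).Adj i' k') →
      nearestDist (x ∘ i₀.succAbove) k' ≤ dist (x (i₀.succAbove k')) (x i₀)) :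
    IsChargeFree η x (i₀.succAbove i') := by
  have hK : ∀ k', (k' = i' ∨ (bondGraph η (x ∘ i₀.succAbove)).Adj i' k') →
      nearestDist x (i₀.succAbove k') = nearestDist (x ∘ i₀.succAbove) k' := fun k' hk' =>
    nearestDist_succAbove_eq x i₀ hN (hb k' hk')
  have hKi := hK i' (Or.inl rfl)
  -- the neighbour set of `i₀.succAbove i'` in `x` is the image of that of `i'` in `x'`
  have hNB : (bondGraph η x).neighborSet (i₀.succAbove i') =
      i₀.succAbove '' (bondGraph η (x ∘ i₀.succAbove)).neighborSet i' := by
    ext j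
    simp only [SimpleGraph.mem_neighborSet, Set.mem_image]
    constructor
    · intro hj
      rcases Fin.eq_self_or_eq_succAbove i₀ j with rfl | ⟨j', rfl⟩
      · exact absurd hj ha
      · exact ⟨j', adj_comp_of_adj_succAbove x _ hη hN hj, rfl⟩
    · rintro ⟨j', hj', rfl⟩
      exact (adj_succAbove_iff x i₀ hKi (hK j' (Or.inr hj'))).2 hj'
  refine ⟨?_, fun j hj => ?_⟩
  · rw [hNB, Set.ncard_image_of_injective _ Fin.succAbove_right_injective, hcf.1]
  · rw [hNB] at hj
    obtain ⟨j', hj', rfl⟩ := hj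
    have hj'adj : (bondGraph η (x ∘ i₀.succAbove)).Adj i' j' := hj'
    -- so is the common-neighbour set across the bond to `i₀.succAbove j'`
    have hC : (bondGraph η x).neighborSet (i₀.succAbove i') ∩
        (bondGraph η x).neighborSet (i₀.succAbove j') =
        i₀.succAbove '' ((bondGraph η (x ∘ i₀.succAbove)).neighborSet i' ∩
          (bondGraph η (x ∘ i₀.succAbove)).neighborSet j') := by
      rw [hNB]
      ext m
      simp only [Set.mem_inter_iff, Set.mem_image, SimpleGraph.mem_neighborSet]
      constructor
      · rintro ⟨⟨m', hm', rfl⟩, hjm⟩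
        exact ⟨m', ⟨hm', (adj_succAbove_iff x i₀ (hK j' (Or.inr hj'adj))
          (hK m' (Or.inr hm'))).1 hjm⟩, rfl⟩
      · rintro ⟨m', ⟨hm'i, hm'j⟩, rfl⟩
        exact ⟨⟨m', hm'i, rfl⟩, (adj_succAbove_iff x i₀ (hK j' (Or.inr hj'adj))
          (hK m' (Or.inr hm'i))).2 hm'j⟩
    rw [ringNumber_def, hC, Set.ncard_image_of_injective _ Fin.succAbove_right_injective]
    exact hcf.2 j' hj'

/-! ### The two exceptional sets of the structure lemma are small -/

/-- **Count (a)**: at most `28` surviving sites are bonded to `i₀` in `x` (they lie within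
`1.01 ρ` of `x i₀`, `ρ = nn(i₀)`, and are pairwise `≥ ρ / 1.01` apart). [folklore] -/
theorem card_le_of_adj_deleted (hN : 2 ≤ N) (hx : Function.Injective x) {A : Finset (Fin N)}
    (hA : ∀ i' ∈ A, (bondGraph (1 / 100 : ℝ) x).Adj (i₀.succAbove i') i₀) : A.card ≤ 28 := by
  have hρ : 0 < nearestDist x i₀ := nearestDist_pos (by omega) hx i₀
  have hx' : Function.Injective (x ∘ i₀.succAbove) := hx.comp Fin.succAbove_right_injective
  rw [← Finset.card_image_of_injective A hx']
  refine card_le_28 _ (x i₀) hρ ?_ ?_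
  · intro c hc
    obtain ⟨i', hi', rfl⟩ := Finset.mem_image.1 hc
    obtain ⟨-, hle⟩ := bondGraph_adj.1 (hA i' hi')
    exact hle.trans (mul_le_mul_of_nonneg_left (min_le_right _ _) (by norm_num))
  · intro c hc d hd hcd
    obtain ⟨i', hi', rfl⟩ := Finset.mem_image.1 hc
    obtain ⟨k', -, rfl⟩ := Finset.mem_image.1 hd
    have hik : i₀.succAbove k' ≠ i₀.succAbove i' := fun e => hcd ((congrArg x e).symm)
    obtain ⟨-, hle⟩ := bondGraph_adj.1 (hA i' hi')
    have h1 : nearestDist x i₀ ≤ dist (x (i₀.succAbove i')) (x i₀) := by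
      rw [dist_comm]; exact nearestDist_le_dist x (Fin.succAbove_ne i₀ i')
    have h2 : dist (x (i₀.succAbove i')) (x i₀) ≤ (1 + 1 / 100) * nearestDist x (i₀.succAbove i') :=
      hle.trans (mul_le_mul_of_nonneg_left (min_le_left _ _) (by norm_num))
    have h3 : nearestDist x (i₀.succAbove i') ≤ dist (x (i₀.succAbove i')) (x (i₀.succAbove k')) :=
      nearestDist_le_dist x hik
    rw [div_le_iff₀ (by norm_num : (0 : ℝ) < 1 + 1 / 100)]
    change _ ≤ dist (x (i₀.succAbove i')) (x (i₀.succAbove k')) * _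
    linarith

/-- **Count (b)**: at most `27` surviving sites have the deleted particle as strict nearest
neighbour (their directions from `x i₀` are pairwise `> 1` apart on the unit sphere). [folklore] -/
theorem card_le_of_strict (hx : Function.Injective x) {W : Finset (Fin N)}
    (hW : ∀ k' ∈ W, dist (x (i₀.succAbove k')) (x i₀) < nearestDist (x ∘ i₀.succAbove) k') :
    W.card ≤ 27 := by
  set uv : Fin N → EuclideanSpace ℝ (Fin 3) := fun k' =>
    (‖x (i₀.succAbove k') - x i₀‖⁻¹ : ℝ) • (x (i₀.succAbove k') - x i₀) with huv
  have hne : ∀ k', x (i₀.succAbove k') - x i₀ ≠ 0 := fun k' =>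
    sub_ne_zero.2 fun e => Fin.succAbove_ne i₀ k' (hx e)
  have hsep : ∀ k' ∈ W, ∀ l' ∈ W, k' ≠ l' → 1 < dist (uv k') (uv l') := by
    intro k' hk' l' hl' hkl
    have hk := hW k' hk'
    have hl := hW l' hl'
    have hdk : nearestDist (x ∘ i₀.succAbove) k' ≤
        dist (x (i₀.succAbove k')) (x (i₀.succAbove l')) :=
      nearestDist_le_dist (x ∘ i₀.succAbove) (Ne.symm hkl)
    have hdl : nearestDist (x ∘ i₀.succAbove) l' ≤
        dist (x (i₀.succAbove l')) (x (i₀.succAbove k')) :=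
      nearestDist_le_dist (x ∘ i₀.succAbove) hkl
    rw [dist_eq_norm]
    refine one_lt_norm_sub_normalize (hne k') (hne l') ?_ ?_
    · rw [sub_sub_sub_cancel_right, ← dist_eq_norm, ← dist_eq_norm]
      linarith
    · rw [sub_sub_sub_cancel_right, ← dist_eq_norm, ← dist_eq_norm, dist_comm (x (i₀.succAbove k'))]
      linarith
  have hinj : Set.InjOn uv W := by
    intro k' hk' l' hl' e
    by_contra hkl
    have := hsep k' hk' l' hl' hkl
    rw [e, dist_self] at this
    linarith
  rw [← Finset.card_image_of_injOn hinj]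
  refine card_le_27 _ ?_ ?_
  · intro c hc
    obtain ⟨k', -, rfl⟩ := Finset.mem_image.1 hc
    rw [huv, dist_zero_right, norm_smul, norm_inv, norm_norm,
      inv_mul_cancel₀ (norm_ne_zero_iff.2 (hne k'))]
  · intro c hc d hd hcd
    obtain ⟨k', hk', rfl⟩ := Finset.mem_image.1 hc
    obtain ⟨l', hl', rfl⟩ := Finset.mem_image.1 hd
    exact (hsep k' hk' l' hl' fun e => hcd (by rw [e])).le

/-! ### The recount -/

/-- **Charge recount** (`N ≥ 2`): `#charged(x) ≤ #charged(x') + 812`.  A charged site of `x`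
is `i₀`, or the image of a charged site of `x'`, or the image of a flipped site; by the structure
lemma the flipped sites lie in `A ∪ W ∪ ⋃_{k' ∈ W} N'(k')` (`A` = sites bonded to `i₀`, `W` =
sites with strict nearest neighbour `x i₀`), of cardinality `≤ 28 + 27 + 27 · 28 = 811`.
[folklore] -/
theorem natCard_charged_le_of_two_le (hN : 2 ≤ N) (hx : Function.Injective x) :
    Nat.card {i : Fin (N + 1) // ¬ IsChargeFree (1 / 100 : ℝ) x i} ≤
      Nat.card {i : Fin N // ¬ IsChargeFree (1 / 100 : ℝ) (x ∘ i₀.succAbove) i} + 812 := by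
  rw [Nat.card_eq_fintype_card, Fintype.card_subtype, Nat.card_eq_fintype_card,
    Fintype.card_subtype]
  have hx' : Function.Injective (x ∘ i₀.succAbove) := hx.comp Fin.succAbove_right_injective
  set G' := bondGraph (1 / 100 : ℝ) (x ∘ i₀.succAbove) with hG'
  set D' : Finset (Fin N) :=
    Finset.univ.filter fun i => ¬ IsChargeFree (1 / 100 : ℝ) (x ∘ i₀.succAbove) i with hD'
  set A : Finset (Fin N) :=
    Finset.univ.filter fun i' => (bondGraph (1 / 100 : ℝ) x).Adj (i₀.succAbove i') i₀ with hA
  set W : Finset (Fin N) := Finset.univ.filter fun k' =>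
    dist (x (i₀.succAbove k')) (x i₀) < nearestDist (x ∘ i₀.succAbove) k' with hW
  set B : Finset (Fin N) :=
    A ∪ (W ∪ W.biUnion fun k' => Finset.univ.filter fun j => G'.Adj k' j) with hB
  have hBcard : B.card ≤ 811 := by
    have h1 : A.card ≤ 28 :=
      card_le_of_adj_deleted x i₀ hN hx fun i' hi' => (Finset.mem_filter.1 hi').2
    have h2 : W.card ≤ 27 := card_le_of_strict x i₀ hx fun k' hk' => (Finset.mem_filter.1 hk').2
    have h3 : (W.biUnion fun k' => Finset.univ.filter fun j => G'.Adj k' j).card ≤ 27 * 28 :=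
      calc (W.biUnion fun k' => Finset.univ.filter fun j => G'.Adj k' j).card
          ≤ ∑ k' ∈ W, (Finset.univ.filter fun j => G'.Adj k' j).card := Finset.card_biUnion_le
        _ ≤ W.card • 28 := Finset.sum_le_card_nsmul _ _ _ fun k' _ =>
            card_le_of_adj hN hx' k' fun j hj => (Finset.mem_filter.1 hj).2
        _ ≤ 27 * 28 := by rw [smul_eq_mul]; omega
    calc B.card ≤ A.card + (W ∪ W.biUnion fun k' => Finset.univ.filter fun j => G'.Adj k' j).card :=
          Finset.card_union_le _ _
      _ ≤ A.card + (W.card +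
          (W.biUnion fun k' => Finset.univ.filter fun j => G'.Adj k' j).card) := by
        gcongr; exact Finset.card_union_le _ _
      _ ≤ 811 := by omega
  have hsub : (Finset.univ.filter fun i => ¬ IsChargeFree (1 / 100 : ℝ) x i) ⊆
      insert i₀ ((D' ∪ B).map (Fin.succAboveEmb i₀)) := by
    intro i hi
    have hbad : ¬ IsChargeFree (1 / 100 : ℝ) x i := (Finset.mem_filter.1 hi).2
    rcases Fin.eq_self_or_eq_succAbove i₀ i with rfl | ⟨i', rfl⟩
    · exact Finset.mem_insert_self _ _
    · refine Finset.mem_insert_of_mem (Finset.mem_map.2 ⟨i', ?_, rfl⟩)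
      rw [Finset.mem_union]
      by_cases hcf : IsChargeFree (1 / 100 : ℝ) (x ∘ i₀.succAbove) i'
      · right
        rw [hB, Finset.mem_union, Finset.mem_union, Finset.mem_biUnion]
        by_contra hB'
        push Not at hB'
        obtain ⟨hBa, hBb, hBc⟩ := hB'
        refine hbad (isChargeFree_succAbove x i₀ (by norm_num) hN hcf ?_ ?_)
        · exact fun h => hBa (Finset.mem_filter.2 ⟨Finset.mem_univ _, h⟩)
        · intro k' hk'
          by_contra hlt
          push Not at hlt
          have hkW : k' ∈ W := Finset.mem_filter.2 ⟨Finset.mem_univ _, hlt⟩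
          rcases hk' with rfl | hadj
          · exact hBb hkW
          · exact hBc k' hkW (Finset.mem_filter.2 ⟨Finset.mem_univ _, hadj.symm⟩)
      · left
        exact Finset.mem_filter.2 ⟨Finset.mem_univ _, hcf⟩
  calc (Finset.univ.filter fun i => ¬ IsChargeFree (1 / 100 : ℝ) x i).card
      ≤ (insert i₀ ((D' ∪ B).map (Fin.succAboveEmb i₀))).card := Finset.card_le_card hsub
    _ ≤ ((D' ∪ B).map (Fin.succAboveEmb i₀)).card + 1 := Finset.card_insert_le _ _
    _ = (D' ∪ B).card + 1 := by rw [Finset.card_map]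
    _ ≤ D'.card + B.card + 1 := by have := Finset.card_union_le D' B; omega
    _ ≤ D'.card + 812 := by omega

end Deletion

/-- **`stub_chargeRecount`** (line `barlow-relative-pricing` of crux `ChargedEnergyGap`,
stmt-AtomisticToContinuum-14231): deleting one particle of an injective configuration of `ℝ³`
raises the number of charged sites (not charge-free at tolerance `1/100`) by at most the absolute
constant `F = 812`, relative to the smaller configuration. [folklore] -/
theorem stub_chargeRecount : ∃ F : ℕ, ∀ (N : ℕ) (x : Fin (N + 1) → EuclideanSpace ℝ (Fin 3)) (i₀ : Fin (N + 1)), Function.Injective x → Nat.card {i : Fin (N + 1) // ¬ Literature.Geometry.DiscreteGeometry.IsChargeFree (1 / 100 : ℝ) x i} ≤ Nat.card {i : Fin N // ¬ Literature.Geometry.DiscreteGeometry.IsChargeFree (1 / 100 : ℝ) (x ∘ Fin.succAbove i₀) i} + F := by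
  refine ⟨812, fun N x i₀ hx => ?_⟩
  rcases lt_or_ge N 2 with hN | hN
  · calc Nat.card {i : Fin (N + 1) // ¬ IsChargeFree (1 / 100 : ℝ) x i}
        ≤ Nat.card (Fin (N + 1)) := Finite.card_subtype_le _
      _ = N + 1 := by rw [Nat.card_eq_fintype_card, Fintype.card_fin]
      _ ≤ _ := by omega
  · exact natCard_charged_le_of_two_le x i₀ hN hx

end Summit.AtomisticToContinuum.Crystallization.Theorems.BarlowRelativePricingRecount

end
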